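import Summits.NavierStokesRegularity.NavierStokesRegularity.Theorems.LocalSineTubeDoorLocalPointZoomZoom
import Summits.NavierStokesRegularity.NavierStokesRegularity.Theorems.TerminalTraceExtinctApexZoom
import HarnessLib

/-!
# Crux `TerminalTrace.TypeITraceScarL3` (stmt-NavierStokesRegularity-18385), line `extinct-apex`:
# STUB 2 `stub_extinctApex_of_L3trace` — a Type-I backward-singular apex point with an `L³`
# terminal trace zooms to an EXTINCT TYPE-I APEX

Prover seat nsreg-p4 (gen 15) for the planner nsreg-p2 (ROUND-24 «the scar at the last slice»,
skeleton `HOME/ns-regularity-ideate-p2/R24-line-extinct-apex.lean`, sha16 07e82d2c7e70161a, Stub 2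
VERBATIM by name and signature; `--supports stmt-NavierStokesRegularity-18385`).  Theorems only.
(The sibling line `apex-dichotomy` (ROUND-25) registers Stub 2′ `stub_extinctApexD_of_L3trace` =
this statement plus a `cknD` clause; this file is the common part.)

In the frame of the item (classical on `[0,T)` with viscosity `ν > 0`, Leray–Hopf on `[0,T]` from
its datum, Type I in time near `T`), let `(T, x₀)` be backward singular and `u(T) ∈ L³(B(x₀, ρ))`.
Proof: (1) the local rate `‖u‖√(ν(T−t)) ≤ C√ν` near `(T, x₀)` from `IsTypeIBlowup`; (2) the tree's
viscosity-normalising zoom `v = α u(T + βs, x₀ + Ry)`, `π = α² q(…)` (`q` the gauged pressure)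
is in Albritton–Barker's class on `Q(0,1)` with the rate and `𝐈(Q(0,½)) < ∞`
(`LocalSineTubeDoorLocalPointZoomZoom.exists_zoom_typeIBound_lt_top_of_localTypeI`, A–B 2019
Lemma 2.5); (3) on `Q(0, ρ')`, `ρ' = min ½ (ρ/R)`: the vertex `0` is backward singular for `v`
(`L^∞` norms under the anisotropic affine map), the top slice `v(0) = α u(T, x₀ + R·)` is in
`L³(B(0, ρ'))`, and the pairings `∫ ⟪v(s), η⟫` are continuous up to `s = 0` by the Leray–Hopf weak
`L²`-continuity of `u` at `T` (`IsLerayHopfOn.weak_continuous`); (4) the zoom theorem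
`TerminalTraceExtinctApexZoom.exists_extinctApex_zoomLimit` (compactness A–B Lemma 2.2 /
persistence Prop. 2.3 / rate / NULL TOP TRACE by Seregin 2014 §6.6) delivers the extinct apex.
The local-Type-I hypothesis of the stub (Stub 1's output) is implied by the others and not used.

WHAT THIS IS NOT: not a regularity or blow-up claim — the blow-up procedure at a hypothetical
Type-I singularity with an `L³` terminal trace; the crux `TypeITraceScarL3` and the open stub
`stub_no_extinctApex` / `stub_no_spreadExtinctApex` are untouched.
-/

noncomputable section

open MeasureTheory Set Function Filter Topology TopologicalSpace Metric
open scoped NNReal ENNReal InnerProductSpace RealInnerProductSpace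
open Literature.Analysis Literature.Analysis.FluidPDE
open Summit.NavierStokesRegularity.NavierStokesRegularity.Theorems.TerminalTraceExtinctApexTopTrace
open Summit.NavierStokesRegularity.NavierStokesRegularity.Theorems.TerminalTraceExtinctApexZoom

namespace Summit.NavierStokesRegularity.NavierStokesRegularity.Theorems.TerminalTraceTypeITraceScarL3StubExtinctApexOfL3trace

variable {u : ℝ → EuclideanSpace ℝ (Fin 3) → EuclideanSpace ℝ (Fin 3)}

/-! ## The anisotropic zoom about `(T, x₀)`: singular vertex, top slice, top pairings -/

/-- The preimage of the anisotropic cylinder `]T − βr², T[ × B(x₀, Rr)` under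
`Φ(s,y) = (T + βs, x₀ + Ry)` is the standard ball `Q(0, r)`. -/
theorem stAffine_preimage_anisotropicCylinder {β R : ℝ} (hβ : 0 < β) (hR : 0 < R) (T : ℝ)
    (x₀ : EuclideanSpace ℝ (Fin 3)) (r : ℝ) :
    stAffine β R T x₀ ⁻¹' (Ioo (T - β * r ^ 2) T ×ˢ ball x₀ (R * r)) =
      parabolicCylinder r (0 : ℝ × EuclideanSpace ℝ (Fin 3)) := by
  rw [stAffine_preimage_cylinder hβ hR, sub_self x₀, smul_zero, sub_self T, zero_div,
    show (T - β * r ^ 2 - T) / β = -r ^ 2 by field_simp; ring, mul_div_cancel_left₀ _ hR.ne']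
  show Ioo (-r ^ 2) 0 ×ˢ ball (0 : EuclideanSpace ℝ (Fin 3)) r =
    Ioo ((0 : ℝ × EuclideanSpace ℝ (Fin 3)).1 - r ^ 2) (0 : ℝ × EuclideanSpace ℝ (Fin 3)).1 ×ˢ
      ball (0 : ℝ × EuclideanSpace ℝ (Fin 3)).2 r
  simp

/-- **A backward singular point stays singular under the anisotropic zoom**: if `(T, x₀)` is a
backward singular point of `u`, the origin is one of `α u(T + βs, x₀ + Ry)` (`α, β, R > 0`). -/
theorem isBackwardSingularPoint_stRescale {α β R T : ℝ} {x₀ : EuclideanSpace ℝ (Fin 3)}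
    (hα : 0 < α) (hβ : 0 < β) (hR : 0 < R)
    (hsing : IsBackwardSingularPoint u ((T, x₀) : ℝ × EuclideanSpace ℝ (Fin 3))) :
    IsBackwardSingularPoint (α • stPull β R T x₀ u) (0 : ℝ × EuclideanSpace ℝ (Fin 3)) := by
  intro r hr
  set S : Set (ℝ × EuclideanSpace ℝ (Fin 3)) := Ioo (T - β * r ^ 2) T ×ˢ ball x₀ (R * r) with hS
  have hpre : stAffine β R T x₀ ⁻¹' S = parabolicCylinder r (0 : ℝ × EuclideanSpace ℝ (Fin 3)) :=
    stAffine_preimage_anisotropicCylinder hβ hR T x₀ r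
  -- a standard ball of the singular vertex inside `S`
  set r' : ℝ := min (R * r) (Real.sqrt β * r) with hr'
  have hr'pos : 0 < r' := lt_min (mul_pos hR hr) (mul_pos (Real.sqrt_pos.2 hβ) hr)
  have hsub : parabolicCylinder r' ((T, x₀) : ℝ × EuclideanSpace ℝ (Fin 3)) ⊆ S := by
    refine prod_mono (Ioo_subset_Ioo ?_ le_rfl) (ball_subset_ball (min_le_left _ _))
    have h1 : r' ≤ Real.sqrt β * r := min_le_right _ _
    have h2 : r' ^ 2 ≤ (Real.sqrt β * r) ^ 2 := pow_le_pow_left₀ hr'pos.le h1 2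
    rw [mul_pow, Real.sq_sqrt hβ.le] at h2
    show T - β * r ^ 2 ≤ T - r' ^ 2
    linarith
  have htop : eLpNorm (uncurry u) ⊤ (volume.restrict S) = ⊤ :=
    eq_top_iff.2 ((hsing r' hr'pos).symm.le.trans
      (eLpNorm_mono_measure _ (Measure.restrict_mono hsub le_rfl)))
  -- `L^∞` norms under the measurable embedding `Φ`
  have hme := measurableEmbedding_stAffine (E := EuclideanSpace ℝ (Fin 3)) hβ.ne' hR.ne' T x₀
  have hF : (fun w : ℝ × EuclideanSpace ℝ (Fin 3) => ‖uncurry (α • stPull β R T x₀ u) w‖ₑ) =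
      fun w => ENNReal.ofReal α * ((fun w' : ℝ × EuclideanSpace ℝ (Fin 3) => ‖uncurry u w'‖ₑ) ∘
        stAffine β R T x₀) w := by
    funext ⟨s, y⟩
    simp only [uncurry_apply_pair, Pi.smul_apply, stPull_apply, enorm_smul, Real.enorm_eq_ofReal hα.le,
      Function.comp_apply, stAffine_apply]
  rw [eLpNorm_exponent_top, eLpNormEssSup_eq_essSup_enorm, ← hpre, hF, ENNReal.essSup_const_mul]
  have h2 := hme.essSup_map_measure (μ := volume.restrict (stAffine β R T x₀ ⁻¹' S))
    (g := fun w' : ℝ × EuclideanSpace ℝ (Fin 3) => ‖uncurry u w'‖ₑ)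
  rw [map_stAffine_volume_restrict_preimage hβ hR, finrank_euclideanSpace_fin,
    essSup_ennreal_smul_measure (by simp; positivity)] at h2
  rw [← h2]
  have htop' : essSup (fun w' : ℝ × EuclideanSpace ℝ (Fin 3) => ‖uncurry u w'‖ₑ) (volume.restrict S) = ⊤ := by
    rwa [eLpNorm_exponent_top, eLpNormEssSup_eq_essSup_enorm] at htop
  rw [htop', ENNReal.mul_top (ENNReal.ofReal_pos.2 hα).ne']

/-- **Pairings of the anisotropic zoom** (change of variables in space):
`∫ ⟪(α u)(T + βs, x₀ + Ry), η(y)⟫ dy = α (R³)⁻¹ ∫ ⟪u(T + βs, x), η(R⁻¹(x − x₀))⟫ dx`. -/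
theorem integral_inner_stRescale_eq (u : ℝ → EuclideanSpace ℝ (Fin 3) → EuclideanSpace ℝ (Fin 3))
    (η : EuclideanSpace ℝ (Fin 3) → EuclideanSpace ℝ (Fin 3)) (α β : ℝ) {R : ℝ} (hR : 0 < R) (T : ℝ)
    (x₀ : EuclideanSpace ℝ (Fin 3)) (s : ℝ) :
    ∫ y, ⟪(α • stPull β R T x₀ u) s y, η y⟫ =
      α * (R ^ 3)⁻¹ * ∫ x, ⟪u (T + β * s) x, η (R⁻¹ • (x - x₀))⟫ := by
  have h := integral_comp_space_affine hR x₀ (fun x => ⟪u (T + β * s) x, η (R⁻¹ • (x - x₀))⟫)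
  rw [finrank_euclideanSpace_fin] at h
  have e : (fun y : EuclideanSpace ℝ (Fin 3) => ⟪(α • stPull β R T x₀ u) s y, η y⟫) =
      fun y => α * ⟪u (T + β * s) (x₀ + R • y), η (R⁻¹ • (x₀ + R • y - x₀))⟫ := by
    funext y
    rw [smul_stPull_apply, real_inner_smul_left, add_sub_cancel_left, smul_smul,
      inv_mul_cancel₀ hR.ne', one_smul]
  rw [e, integral_const_mul, h, smul_eq_mul, mul_assoc]

/-- **Weak `L²`-continuity at the top time transports to the zoom.**  For a Leray–Hopf solution on
`[0, T]` the pairings `s ↦ ∫ ⟪(α u)(T + βs, x₀ + R·), η⟫` with `η ∈ C_c^∞` tend, as `s ↑ 0`, to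
the pairing of the zoomed terminal value `α u(T, x₀ + R·)`. -/
theorem tendsto_integral_inner_stRescale_nhdsLT {ν T : ℝ} (hT : 0 < T) (hLH : IsLerayHopfOn T ν 0 (u 0) u)
    (α : ℝ) {β R : ℝ} (hβ : 0 < β) (hR : 0 < R) (x₀ : EuclideanSpace ℝ (Fin 3)) :
    ∀ η : EuclideanSpace ℝ (Fin 3) → EuclideanSpace ℝ (Fin 3), ContDiff ℝ (⊤ : ℕ∞) η →
      HasCompactSupport η →
      Tendsto (fun s => ∫ y, ⟪(α • stPull β R T x₀ u) s y, η y⟫)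
        (𝓝[<] (0 : ℝ × EuclideanSpace ℝ (Fin 3)).1)
        (𝓝 (∫ y, ⟪(α • stPull β R T x₀ u) (0 : ℝ × EuclideanSpace ℝ (Fin 3)).1 y, η y⟫)) := by
  intro η hη hηc
  obtain ⟨hηk, hηkc⟩ := contDiff_hasCompactSupport_comp_zoom hη hηc hR x₀
  have hmem : MemLp (fun x => η (R⁻¹ • (x - x₀))) 2 volume :=
    hηk.continuous.memLp_of_hasCompactSupport hηkc
  have hcont := (hLH.weak_continuous _ hmem).1
  set g : ℝ → ℝ := fun t => ∫ x, ⟪u t x, η (R⁻¹ • (x - x₀))⟫ with hg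
  have hgT : Tendsto g (𝓝[<] T) (𝓝 (g T)) := by
    have h := (hcont.continuousWithinAt (right_mem_Ioc.2 hT)).tendsto
    refine h.mono_left ?_
    rw [← nhdsWithin_Ioo_eq_nhdsLT hT]
    exact nhdsWithin_mono _ Ioo_subset_Ioc_self
  have htime : Tendsto (fun s : ℝ => T + β * s) (𝓝[<] (0 : ℝ)) (𝓝[<] T) := by
    refine tendsto_nhdsWithin_iff.2 ⟨?_, ?_⟩
    · have h : Tendsto (fun s : ℝ => T + β * s) (𝓝 0) (𝓝 (T + β * 0)) :=
        ((continuous_const.add (continuous_const.mul continuous_id)).tendsto 0)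
      rw [mul_zero, add_zero] at h
      exact h.mono_left nhdsWithin_le_nhds
    · refine eventually_mem_nhdsWithin.mono fun s hs => ?_
      have hs' : s < 0 := hs
      show T + β * s < T
      nlinarith
  have h2 := (hgT.comp htime).const_mul (α * (R ^ 3)⁻¹)
  have e : (fun s => ∫ y, ⟪(α • stPull β R T x₀ u) s y, η y⟫) =
      fun s => α * (R ^ 3)⁻¹ * g (T + β * s) :=
    funext fun s => integral_inner_stRescale_eq u η α β hR T x₀ s
  rw [show (0 : ℝ × EuclideanSpace ℝ (Fin 3)).1 = (0 : ℝ) from rfl, e,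
    integral_inner_stRescale_eq u η α β hR T x₀ 0, mul_zero, add_zero]
  exact h2

/-! ## STUB 2 -/

/-- **STUB 2 of the line `extinct-apex`, PROVED** (Albritton–Barker 2019 Lemma 2.2 / Prop. 2.3 /
Lemma 2.5; Barker–Prange 2020 §4; Seregin 2014 §6.6 p. 127).  In the frame of the item, a
backward-singular apex point `(T, x₀)` of a Type-I-in-time blow-up whose terminal value `u T` lies
in `L³` of a ball around `x₀` yields — after ν-normalisation and a parabolic zoom along a
subsequence — an EXTINCT TYPE-I APEX: a pair `(U, P)` in Albritton–Barker's class on every `Q(a)`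
about the origin, with a weak gradient and `𝐈(Q(a)) ≤ M` at every scale, the rate `C/√(−s)`,
singular at the origin, and weakly vanishing at the top time.  (Verbatim the skeleton's statement;
the local-Type-I hypothesis is not needed.) -/
theorem stub_extinctApex_of_L3trace :
    ∀ (ν T : ℝ), 0 < ν → 0 < T →
      ∀ (u : ℝ → EuclideanSpace ℝ (Fin 3) → EuclideanSpace ℝ (Fin 3))
        (p : ℝ → EuclideanSpace ℝ (Fin 3) → ℝ),
      IsClassicalNSSolutionOn (Ico 0 T) ν 0 u p → IsLerayHopfOn T ν 0 (u 0) u →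
      IsTypeIBlowup u T → ∀ x₀ : EuclideanSpace ℝ (Fin 3),
      (∃ r₀ : ℝ, 0 < r₀ ∧
        ∃ G : ℝ → EuclideanSpace ℝ (Fin 3) →
          EuclideanSpace ℝ (Fin 3) →L[ℝ] EuclideanSpace ℝ (Fin 3),
          HasWeakSpatialGradientOn (parabolicCylinderOpens r₀ (T, x₀)) u G ∧
          typeIBound (parabolicCylinder r₀ (T, x₀)) u p G < ∞) →
      (∀ r : ℝ, 0 < r →
        eLpNorm (uncurry u) ⊤ (volume.restrict (parabolicCylinder r (T, x₀))) = ⊤) →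
      (∃ ρ : ℝ, 0 < ρ ∧ MemLp (u T) 3 (volume.restrict (ball x₀ ρ))) →
        ∃ (U : ℝ → EuclideanSpace ℝ (Fin 3) → EuclideanSpace ℝ (Fin 3))
          (P : ℝ → EuclideanSpace ℝ (Fin 3) → ℝ)
          (G : ℝ → EuclideanSpace ℝ (Fin 3) →
            EuclideanSpace ℝ (Fin 3) →L[ℝ] EuclideanSpace ℝ (Fin 3))
          (M : ℝ≥0) (C : ℝ),
          (∀ a : ℝ, 0 < a →
            IsSuitableWeakSolutionInBall a (0 : ℝ × EuclideanSpace ℝ (Fin 3)) U P) ∧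
          (∀ a : ℝ, 0 < a →
            HasWeakSpatialGradientOn
              (parabolicCylinderOpens a (0 : ℝ × EuclideanSpace ℝ (Fin 3))) U G) ∧
          (∀ a : ℝ, 0 < a →
            typeIBound (parabolicCylinder a (0 : ℝ × EuclideanSpace ℝ (Fin 3))) U P G ≤ M) ∧
          (∀ s : ℝ, s < 0 →
            ∀ᵐ y : EuclideanSpace ℝ (Fin 3), ‖U s y‖ ≤ C / Real.sqrt (-s)) ∧
          (∀ φ : EuclideanSpace ℝ (Fin 3) → EuclideanSpace ℝ (Fin 3),
            ContDiff ℝ (⊤ : ℕ∞) φ →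
            HasCompactSupport φ → ∀ ε : ℝ, 0 < ε →
            ∃ s₀ : ℝ, s₀ < 0 ∧ ∀ᵐ s ∂(volume.restrict (Ioo s₀ 0)), |∫ y, ⟪U s y, φ y⟫| ≤ ε) ∧
          IsBackwardSingularPoint U (0 : ℝ × EuclideanSpace ℝ (Fin 3)) := by
  intro ν T hν hT u p hsol hLH hTI x₀ _hloc hsing hL3
  obtain ⟨ρ₃, hρ₃, hmem⟩ := hL3
  -- (1) the local rate from the Type-I-in-time hypothesis
  obtain ⟨C, hC⟩ := hTI
  obtain ⟨l, hlT, hl⟩ := (mem_nhdsLT_iff_exists_Ioo_subset' (show T - 1 < T by linarith)).1 hC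
  have hlT' : l < T := hlT
  set ρr : ℝ := Real.sqrt (T - l) with hρrdef
  have hρr : 0 < ρr := Real.sqrt_pos.2 (by linarith)
  have hρr2 : ρr ^ 2 = T - l := Real.sq_sqrt (by linarith)
  have hM : ∀ t ∈ Ico 0 T, T - ρr ^ 2 < t → ∀ x ∈ ball x₀ ρr,
      ‖u t x‖ * Real.sqrt (ν * (T - t)) ≤ C * Real.sqrt ν := by
    intro t ht hlt x _
    have hrate : ‖u t x‖ ≤ C / Real.sqrt (T - t) := hl ⟨by linarith, ht.2⟩ x
    have hst : 0 < Real.sqrt (T - t) := Real.sqrt_pos.2 (by linarith [ht.2])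
    calc ‖u t x‖ * Real.sqrt (ν * (T - t))
        ≤ C / Real.sqrt (T - t) * Real.sqrt (ν * (T - t)) :=
          mul_le_mul_of_nonneg_right hrate (Real.sqrt_nonneg _)
      _ = C * Real.sqrt ν := by
          rw [Real.sqrt_mul hν.le]; field_simp
  -- (2) the viscosity-normalising zoom (A–B Lemma 2.5 in the zoomed frame)
  obtain ⟨R, α, β, hR, hα, hβ, -, -, -, hRρ, -, hball1, hG1, hrate1, hI⟩ :=
    Summit.NavierStokesRegularity.NavierStokesRegularity.Theorems.LocalSineTubeDoorLocalPointZoomZoom.exists_zoom_typeIBound_lt_top_of_localTypeI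
      hν hT hsol hLH hρr hM
  set q : ℝ → EuclideanSpace ℝ (Fin 3) → ℝ := fun t x => p t x - (p t 0 - normalisedPressure (u t) 0)
    with hq
  set v : ℝ → EuclideanSpace ℝ (Fin 3) → EuclideanSpace ℝ (Fin 3) := α • stPull β R T x₀ u with hv
  set π : ℝ → EuclideanSpace ℝ (Fin 3) → ℝ := α ^ 2 • stPull β R T x₀ q with hπ
  set Gv : ℝ → EuclideanSpace ℝ (Fin 3) → EuclideanSpace ℝ (Fin 3) →L[ℝ] EuclideanSpace ℝ (Fin 3) :=
    (α * R) • stPull β R T x₀ fun t x => fderiv ℝ (u t) x with hGv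
  -- (3) the radius `ρ' = min (1/2) (ρ₃ / R)`
  set ρ' : ℝ := min (1 / 2) (ρ₃ / R) with hρ'def
  have hρ' : 0 < ρ' := lt_min (by norm_num) (div_pos hρ₃ hR)
  have hρ'half : ρ' ≤ 1 / 2 := min_le_left _ _
  have hRρ' : R * ρ' ≤ ρ₃ := by
    have h : ρ' ≤ ρ₃ / R := min_le_right _ _
    rw [le_div_iff₀ hR] at h
    linarith [mul_comm R ρ']
  have hsub_half : parabolicCylinder ρ' (0 : ℝ × EuclideanSpace ℝ (Fin 3)) ⊆
      parabolicCylinder (1 / 2) (0 : ℝ × EuclideanSpace ℝ (Fin 3)) :=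
    parabolicCylinder_mono hρ'.le hρ'half _
  have hsub_one : parabolicCylinder ρ' (0 : ℝ × EuclideanSpace ℝ (Fin 3)) ⊆
      parabolicCylinder 1 (0 : ℝ × EuclideanSpace ℝ (Fin 3)) :=
    parabolicCylinder_mono hρ'.le (hρ'half.trans (by norm_num)) _
  have hballρ : IsSuitableWeakSolutionInBall ρ' 0 v π := hball1.of_subset_zero hρ' hsub_one
  have hwgρ : HasWeakSpatialGradientOn (parabolicCylinderOpens ρ' (0 : ℝ × EuclideanSpace ℝ (Fin 3)))
      v Gv := hG1.mono fun w hw => hsub_one hw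
  have hIρ : typeIBound (parabolicCylinder ρ' (0 : ℝ × EuclideanSpace ℝ (Fin 3))) v π Gv < ⊤ :=
    lt_of_le_of_lt (typeIBound_mono hsub_half) hI
  -- the rate on `Q(0, ρ')`
  have hρrR : 1 ≤ ρr / R := by rw [le_div_iff₀ hR, one_mul]; exact hRρ
  have hrateρ : ∀ (t : ℝ) (x : EuclideanSpace ℝ (Fin 3)),
      (t, x) ∈ parabolicCylinder ρ' (0 : ℝ × EuclideanSpace ℝ (Fin 3)) →
      ‖v t x‖ ≤ (α * max (C * Real.sqrt ν) 0 / Real.sqrt (ν * β)) /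
        Real.sqrt ((0 : ℝ × EuclideanSpace ℝ (Fin 3)).1 - t) := by
    intro t x htx
    rw [mem_parabolicCylinder] at htx
    simp only [Prod.fst_zero, Prod.snd_zero, zero_sub, dist_zero_right] at htx
    obtain ⟨⟨ht1, ht2⟩, hx⟩ := htx
    have ht : t ∈ Ioo (-1 : ℝ) 0 := ⟨by nlinarith, ht2⟩
    have hx' : x ∈ ball (0 : EuclideanSpace ℝ (Fin 3)) (ρr / R) := by
      rw [mem_ball, dist_zero_right]
      linarith
    have h := hrate1 t ht x hx'
    rw [show (0 : ℝ × EuclideanSpace ℝ (Fin 3)).1 - t = -t by simp]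
    exact h
  -- the singular vertex, the top slice and the top pairings
  have hsingv : IsBackwardSingularPoint v (0 : ℝ × EuclideanSpace ℝ (Fin 3)) :=
    isBackwardSingularPoint_stRescale hα hβ hR hsing
  have hv0 : v (0 : ℝ × EuclideanSpace ℝ (Fin 3)).1 = fun y => α • u T (x₀ + R • y) := by
    funext y
    show (α • stPull β R T x₀ u) 0 y = _
    rw [smul_stPull_apply, mul_zero, add_zero]
  have htopv : MemLp (v (0 : ℝ × EuclideanSpace ℝ (Fin 3)).1) 3
      (volume.restrict (ball (0 : ℝ × EuclideanSpace ℝ (Fin 3)).2 ρ')) := by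
    rw [hv0]
    exact memLp_three_top_slice α hR hRρ' hmem
  have htopm : AEStronglyMeasurable (v (0 : ℝ × EuclideanSpace ℝ (Fin 3)).1) volume := by
    rw [hv0]
    exact aestronglyMeasurable_top_slice (hLH.memLp T ⟨hT.le, le_rfl⟩).1 α hR x₀
  have hwcv := tendsto_integral_inner_stRescale_nhdsLT hT hLH α hβ hR x₀
  -- (4) the zoom theorem
  exact exists_extinctApex_zoomLimit hρ' hballρ hwgρ hIρ hrateρ hsingv htopv htopm hwcv

end Summit.NavierStokesRegularity.NavierStokesRegularity.Theorems.TerminalTraceTypeITraceScarL3StubExtinctApexOfL3trace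

end
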